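import Mathlib.RepresentationTheory.Maschke
import Mathlib.RingTheory.SimpleModule.IsAlgClosed
import Mathlib.Data.Prod.Lex
import Literature.Combinatorics.Additive.SliceRankAntichain
import Literature.Barriers.MatrixMultiplication.NilpotentGroupBarrier
import HarnessLib

/-!
# Full slice rank of `⟨n,n,n⟩` and of semisimple group algebras (BCCGU 2017, B.6, B.7) — proofs

Topic `Literature/Barriers/MatrixMultiplication`; proof file attached to the catalogue entry
`NilpotentGroupBarrier.lean`, discharging two of its named facts:

* `BCCGU2017_corB7_holds : BCCGU2017_corB7` — over an algebraically closed field `K` whose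
  characteristic does not divide `|G|`, `slice-rank(D_G) = |G|` (Blasiak–Church–Cohn–Grochow–Umans
  2017, App. B, Cor. B.7: "The flat rank and slice rank of a direct sum of matrix multiplication tensors
  are full. In particular, the flat rank and slice rank of any semisimple group algebra `𝔽[G]` are
  equal to `|G|`").
* `BCCGU2017_propB6_holds : BCCGU2017_propB6` — `slice-rank ⟨n,n,n⟩ = n²` (ibid., Prop. B.6, slice-rank
  part).

## The proof formalised here

The printed proofs go through FLAT RANK (Def. B.1–Thm. B.4: flat rank is a lower bound for slice rank
and is additive under `⊕`, by a Zariski-genericity argument over an infinite field) and Flanders'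
theorem on spaces of bounded-rank matrices (Prop. B.6). We prove the same STATEMENTS by the
combinatorial route of Sawin–Tao (blog notes 2016, Prop. 4 — `SliceRankAntichain.lean`): in the
matrix-unit bases the support of `⊕ᵢ ⟨dᵢ,dᵢ,dᵢ⟩` (the tree's `matMulDirectSum K d d d`),
`{((i;α,γ), (i;α,β), (i;β,γ))}`, is an ANTICHAIN for the lexicographic keys
`(i↑, α↑, γ↑)`, `(i↑, α↓, β↑)`, `(i↓, β↓, γ↓)`, so a slice decomposition with `k` slices yields a zero
box `A × B × C` with `3 Σᵢ dᵢ² ≤ k + |A| + |B| + |C|`; and a zero box of `⊕ᵢ ⟨dᵢ,dᵢ,dᵢ⟩` has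
`|A| + |B| + |C| ≤ 2 Σᵢ dᵢ²` (for each block `i` and each `(α,β,γ)` at most two of
`(α,γ) ∈ Aᵢ`, `(α,β) ∈ Bᵢ`, `(β,γ) ∈ Cᵢ` hold; average over `(α,β,γ)`). Hence
`slice-rank(⊕ᵢ ⟨dᵢ,dᵢ,dᵢ⟩) ≥ Σᵢ dᵢ²` over EVERY field (`le_sliceRank_matMulDirectSum`; the first
sentence of Cor. B.7, slice-rank part, and for one block Prop. B.6). For Cor. B.7: by Maschke and
Wedderburn–Artin over the algebraically closed field `K` (Mathlib), `K[G] ≃ₐ ∏ᵢ K^{dᵢ×dᵢ}` with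
`Σ dᵢ² = |G|`; isomorphic algebras have restriction-equivalent structure tensors
(`structureTensor_restrictsTo_of_algEquiv`, `GroupAlgebraTensor.lean`), the structure tensor of the
block algebra is `matMulDirectSum K d d d` (`structureTensor_blockBasis_eq_matMulDirectSum`), slice
rank is monotone under restriction (`sliceRank_le_of_tensorRestrictsTo`), and
`slice-rank(M_G) = slice-rank(D_G)` (`sliceRank_groupTensor`).

## References

* J. Blasiak, T. Church, H. Cohn, J. A. Grochow, C. Umans, *Which groups are amenable to proving
  exponent two for matrix multiplication?*, arXiv:1712.02302 (2017), App. B: Prop. B.6, Cor. B.7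
  (held text `paper:arxiv-1712.02302`, p. 14). [BlasiakChurchCohnGrochowUmans2017]
* W. Sawin, T. Tao, *Notes on the "slice rank" of tensors*, What's new (blog), 24 August 2016,
  Prop. 4. [SawinTao2016]
* Wedderburn–Artin / Maschke: Mathlib (`IsSemisimpleRing.exists_algEquiv_pi_matrix_of_isAlgClosed`),
  as in `Literature/RepresentationTheory/FiniteGroups/WedderburnBlocks.lean` for `ℂ[G]`.
-/

noncomputable section

open scoped BigOperators
open Module Finset

namespace Literature.Barriers.MatrixMultiplication

open Literature.Combinatorics.Additive Literature.Computability.AlgebraicComplexity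

universe u

/-! ## Zero boxes of `⊕ᵢ ⟨dᵢ,dᵢ,dᵢ⟩` are small -/

section DirectSum

variable (K : Type u) [Field K] {r : ℕ} (d : Fin r → ℕ)

/-- The support of `⊕ᵢ ⟨dᵢ,dᵢ,dᵢ⟩ = matMulDirectSum K d d d`: the entry at
`((i;α,γ), (i';α',β), (i'';β',γ'))` is non-zero iff `i = i' = i''`, `α = α'`, `β = β'`, `γ = γ'`
(block indices and inner indices compared in `ℕ`). [folklore] -/
theorem matMulDirectSum_ne_zero_iff {a b c : Σ i, Fin (d i) × Fin (d i)} :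
    matMulDirectSum K d d d a b c ≠ 0 ↔
      (a.1 : ℕ) = b.1 ∧ (b.1 : ℕ) = c.1 ∧ (a.2.1 : ℕ) = b.2.1 ∧ (b.2.2 : ℕ) = c.2.1 ∧
        (a.2.2 : ℕ) = c.2.2 := by
  unfold matMulDirectSum
  rw [← Fin.ext_iff, ← Fin.ext_iff]
  split_ifs with h
  · exact ⟨fun _ => h, fun _ => one_ne_zero⟩
  · exact ⟨fun h0 => absurd rfl h0, fun hc => absurd hc h⟩

/-- Two block indices with the same block and the same inner coordinates (compared in `ℕ`) are equal.
[folklore] -/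
theorem blockIndex_ext {x x' : Σ i, Fin (d i) × Fin (d i)} (h1 : (x.1 : ℕ) = x'.1)
    (h2 : (x.2.1 : ℕ) = x'.2.1) (h3 : (x.2.2 : ℕ) = x'.2.2) : x = x' := by
  obtain ⟨i, p, q⟩ := x
  obtain ⟨i', p', q'⟩ := x'
  obtain rfl : i = i' := Fin.ext h1
  simp only at h2 h3
  obtain rfl : p = p' := Fin.ext h2
  obtain rfl : q = q' := Fin.ext h3
  rfl

/-- **Zero boxes of `⊕ᵢ ⟨dᵢ,dᵢ,dᵢ⟩` have `|A| + |B| + |C| ≤ 2 Σᵢ dᵢ²`.** If the tensor vanishes on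
`A × B × C` then for every block `i` and all `α, β, γ < dᵢ` at most two of `(i;α,γ) ∈ A`,
`(i;α,β) ∈ B`, `(i;β,γ) ∈ C` hold (the three together sit on the support); summing over
`(α,β,γ)` gives `dᵢ(|Aᵢ| + |Bᵢ| + |Cᵢ|) ≤ 2dᵢ³`. (The counting step replacing Flanders' theorem in
BCCGU 2017, Prop. B.6 / Cor. B.7 under the Sawin–Tao formulation; cf. Sawin–Tao 2016, Example 5 for
the diagonal tensor.) [folklore] -/
theorem card_zeroBox_matMulDirectSum_le (A B C : Finset (Σ i, Fin (d i) × Fin (d i)))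
    (h0 : ∀ a ∈ A, ∀ b ∈ B, ∀ c ∈ C, matMulDirectSum K d d d a b c = 0) :
    A.card + B.card + C.card ≤ 2 * ∑ i, d i ^ 2 := by
  classical
  -- indicators of the three sets, read in block `i`
  let χA : (i : Fin r) → Fin (d i) → Fin (d i) → ℕ := fun i α γ =>
    if (⟨i, (α, γ)⟩ : Σ i, Fin (d i) × Fin (d i)) ∈ A then 1 else 0
  let χB : (i : Fin r) → Fin (d i) → Fin (d i) → ℕ := fun i α β =>
    if (⟨i, (α, β)⟩ : Σ i, Fin (d i) × Fin (d i)) ∈ B then 1 else 0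
  let χC : (i : Fin r) → Fin (d i) → Fin (d i) → ℕ := fun i β γ =>
    if (⟨i, (β, γ)⟩ : Σ i, Fin (d i) × Fin (d i)) ∈ C then 1 else 0
  -- cardinalities as sums of indicators over the blocks
  have hcard : ∀ S : Finset (Σ i, Fin (d i) × Fin (d i)),
      S.card = ∑ i, ∑ α : Fin (d i), ∑ γ : Fin (d i),
        if (⟨i, (α, γ)⟩ : Σ i, Fin (d i) × Fin (d i)) ∈ S then 1 else 0 := by
    intro S
    have h : S.card = ∑ x : (Σ i, Fin (d i) × Fin (d i)), if x ∈ S then 1 else 0 := by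
      rw [Finset.sum_ite_mem, Finset.univ_inter, Finset.sum_const, smul_eq_mul, mul_one]
    rw [h, Fintype.sum_sigma]
    exact Finset.sum_congr rfl fun i _ => Fintype.sum_prod_type _
  -- pointwise: at most two of the three indicators are `1`
  have hpt : ∀ i (α β γ : Fin (d i)), χA i α γ + χB i α β + χC i β γ ≤ 2 := by
    intro i α β γ
    simp only [χA, χB, χC]
    split_ifs with h1 h2 h3 <;> try omega
    exfalso
    have h := h0 _ h1 _ h2 _ h3
    rw [matMulDirectSum_block] at h
    simp [matMulTensor] at h
  -- per block: `dᵢ (|Aᵢ| + |Bᵢ| + |Cᵢ|) ≤ 2 dᵢ³`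
  have hblock : ∀ i, (∑ α, ∑ γ, χA i α γ) + (∑ α, ∑ β, χB i α β) + (∑ β, ∑ γ, χC i β γ) ≤
      2 * d i ^ 2 := by
    intro i
    have hT1 : ∑ α : Fin (d i), ∑ _β : Fin (d i), ∑ γ, χA i α γ = d i * ∑ α, ∑ γ, χA i α γ := by
      rw [Finset.mul_sum]
      refine Finset.sum_congr rfl fun α _ => ?_
      rw [Finset.sum_const, Finset.card_univ, Fintype.card_fin, smul_eq_mul]
    have hT2 : ∑ α : Fin (d i), ∑ β : Fin (d i), ∑ _γ : Fin (d i), χB i α β =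
        d i * ∑ α, ∑ β, χB i α β := by
      rw [Finset.mul_sum]
      refine Finset.sum_congr rfl fun α _ => ?_
      rw [Finset.mul_sum]
      refine Finset.sum_congr rfl fun β _ => ?_
      rw [Finset.sum_const, Finset.card_univ, Fintype.card_fin, smul_eq_mul]
    have hT3 : ∑ _α : Fin (d i), ∑ β : Fin (d i), ∑ γ, χC i β γ = d i * ∑ β, ∑ γ, χC i β γ := by
      rw [Finset.sum_const, Finset.card_univ, Fintype.card_fin, smul_eq_mul]
    have hS : ∑ α : Fin (d i), ∑ β : Fin (d i), ∑ γ : Fin (d i), (χA i α γ + χB i α β + χC i β γ) ≤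
        ∑ _α : Fin (d i), ∑ _β : Fin (d i), ∑ _γ : Fin (d i), 2 :=
      Finset.sum_le_sum fun α _ => Finset.sum_le_sum fun β _ => Finset.sum_le_sum fun γ _ =>
        hpt i α β γ
    have h2 : ∑ _α : Fin (d i), ∑ _β : Fin (d i), ∑ _γ : Fin (d i), (2 : ℕ) =
        d i * (2 * d i ^ 2) := by
      simp only [Finset.sum_const, Finset.card_univ, Fintype.card_fin, smul_eq_mul]
      ring
    simp only [Finset.sum_add_distrib, hT1, hT2, hT3, h2, ← mul_add] at hS
    rcases Nat.eq_zero_or_pos (d i) with hd | hd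
    · -- empty block
      have hA : ∑ α : Fin (d i), ∑ γ : Fin (d i), χA i α γ = 0 := by
        rw [Finset.sum_eq_zero]; intro α _; exact absurd α.2 (by omega)
      have hB : ∑ α : Fin (d i), ∑ β : Fin (d i), χB i α β = 0 := by
        rw [Finset.sum_eq_zero]; intro α _; exact absurd α.2 (by omega)
      have hC : ∑ β : Fin (d i), ∑ γ : Fin (d i), χC i β γ = 0 := by
        rw [Finset.sum_eq_zero]; intro β _; exact absurd β.2 (by omega)
      rw [hA, hB, hC]
      exact Nat.zero_le _
    · exact Nat.le_of_mul_le_mul_left hS hd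
  -- sum over the blocks
  rw [hcard A, hcard B, hcard C, ← Finset.sum_add_distrib, ← Finset.sum_add_distrib, Finset.mul_sum]
  exact Finset.sum_le_sum fun i _ => hblock i

/-- **`slice-rank(⊕ᵢ ⟨dᵢ,dᵢ,dᵢ⟩) ≥ Σᵢ dᵢ²` over every field** (hence `= Σᵢ dᵢ²`, the side length):
the slice-rank part of "the flat rank and slice rank of a direct sum of matrix multiplication tensors
are full" (Blasiak–Church–Cohn–Grochow–Umans 2017, Cor. B.7, first sentence; Prop. B.6 for one
block), proved via Sawin–Tao's Prop. 4: the support of `matMulDirectSum K d d d` is an antichain for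
the lexicographic keys `(i, α, γ)`, `(i, -α, β)`, `(-i, -β, -γ)` on the three index sets, and its zero
boxes are small (`card_zeroBox_matMulDirectSum_le`).
[cite: BlasiakChurchCohnGrochowUmans2017, Cor. B.7] -/
theorem le_sliceRank_matMulDirectSum : ∑ i, d i ^ 2 ≤ sliceRank (matMulDirectSum K d d d) := by
  classical
  -- the three lexicographic keys
  let ex : (Σ i, Fin (d i) × Fin (d i)) → ℤ ×ₗ (ℤ ×ₗ ℤ) := fun a =>
    toLex (((a.1 : ℕ) : ℤ), toLex (((a.2.1 : ℕ) : ℤ), ((a.2.2 : ℕ) : ℤ)))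
  let ey : (Σ i, Fin (d i) × Fin (d i)) → ℤ ×ₗ (ℤ ×ₗ ℤ) := fun b =>
    toLex (((b.1 : ℕ) : ℤ), toLex (-((b.2.1 : ℕ) : ℤ), ((b.2.2 : ℕ) : ℤ)))
  let ez : (Σ i, Fin (d i) × Fin (d i)) → ℤ ×ₗ (ℤ ×ₗ ℤ) := fun c =>
    toLex (-((c.1 : ℕ) : ℤ), toLex (-((c.2.1 : ℕ) : ℤ), -((c.2.2 : ℕ) : ℤ)))
  -- the support is an antichain for these keys
  have hanti : ∀ a b c a' b' c', matMulDirectSum K d d d a b c ≠ 0 →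
      matMulDirectSum K d d d a' b' c' ≠ 0 → ex a ≤ ex a' → ey b ≤ ey b' → ez c ≤ ez c' →
      a = a' ∧ b = b' ∧ c = c' := by
    intro a b c a' b' c' h h' ha hb hc
    rw [matMulDirectSum_ne_zero_iff] at h h'
    simp only [ex, ey, ez, Prod.Lex.toLex_le_toLex] at ha hb hc
    obtain ⟨h1, h2, h3, h4, h5⟩ := h
    obtain ⟨h1', h2', h3', h4', h5'⟩ := h'
    refine ⟨blockIndex_ext d ?_ ?_ ?_, blockIndex_ext d ?_ ?_ ?_, blockIndex_ext d ?_ ?_ ?_⟩ <;>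
      omega
  obtain ⟨A, B, C, hbox, hk⟩ :=
    (hasSliceRankLE_sliceRank (matMulDirectSum K d d d)).exists_zeroBox_of_antichain ex ey ez hanti
  have hABC := card_zeroBox_matMulDirectSum_le K d A B C hbox
  have hI : Fintype.card (Σ i, Fin (d i) × Fin (d i)) = ∑ i, d i ^ 2 := by
    simp [sq]
  omega

end DirectSum

/-! ## Wedderburn decomposition of `K[G]` over an algebraically closed field of good characteristic -/

section Wedderburn

/-- **Maschke + Wedderburn–Artin**: for a finite group `G` and an algebraically closed field `K`
with `|G| ≠ 0` in `K`, there are block sizes `d₁, …, d_r ≥ 1` and an algebra isomorphism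
`K[G] ≃ₐ[K] ∏ᵢ K^{dᵢ×dᵢ}` (from Mathlib: `K[G]` is semisimple, and
`IsSemisimpleRing.exists_algEquiv_pi_matrix_of_isAlgClosed`; the case `K = ℂ` is the tree's
`Literature.RepresentationTheory.FiniteGroups.exists_algEquiv_pi_matrix`). This is the reading of
"semisimple group algebra `𝔽[G] ≅ ⊕ M_{dᵢ}(𝔽)`" in BCCGU 2017, App. B (with the standing reduction to
an algebraically closed field, remark after Thm. B.4). [folklore] -/
theorem exists_algEquiv_blockAlgebra (K : Type) [Field K] [IsAlgClosed K] (G : Type) [Group G]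
    [Fintype G] (hG : (Fintype.card G : K) ≠ 0) :
    ∃ (r : ℕ) (d : Fin r → ℕ), (∀ i, NeZero (d i)) ∧
      Nonempty (MonoidAlgebra K G ≃ₐ[K] BlockAlgebra K d) := by
  haveI : NeZero (Nat.card G : K) := ⟨by rwa [Nat.card_eq_fintype_card]⟩
  haveI : Module.Finite K (MonoidAlgebra K G) := Module.Finite.of_basis (MonoidAlgebra.basis G K)
  exact IsSemisimpleRing.exists_algEquiv_pi_matrix_of_isAlgClosed K (MonoidAlgebra K G)

/-- **`Σᵢ dᵢ² = |G|`** for every algebra isomorphism `K[G] ≃ₐ ∏ᵢ K^{dᵢ×dᵢ}` (dimension count; for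
`ℂ` this is the tree's `sum_sq_blockDegrees_eq_card`). [folklore] -/
theorem sum_sq_eq_card_of_algEquiv (K : Type) [Field K] (G : Type) [Group G] [Fintype G] {r : ℕ}
    {d : Fin r → ℕ} (φ : MonoidAlgebra K G ≃ₐ[K] BlockAlgebra K d) :
    ∑ i, d i ^ 2 = Fintype.card G := by
  have h1 : finrank K (MonoidAlgebra K G) = Fintype.card G :=
    Module.finrank_eq_card_basis (MonoidAlgebra.basis G K)
  have h2 : finrank K (BlockAlgebra K d) = ∑ i, d i ^ 2 := by
    rw [Module.finrank_pi_fintype]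
    simp [Module.finrank_matrix, sq]
  rw [← h2, ← φ.toLinearEquiv.finrank_eq, h1]

end Wedderburn

/-! ## The discharges -/

section Discharge

/-- **BCCGU 2017, Corollary B.7, discharged**: over an algebraically closed field `K` with
`char K ∤ |G|`, `slice-rank(D_G) = |G|`. Proof: `≤` is trivial (`sliceRank_le_card`); for `≥`,
`K[G] ≃ₐ ∏ᵢ K^{dᵢ×dᵢ}` (`exists_algEquiv_blockAlgebra`), so the structure tensor `M_G` of `K[G]`
restricts to that of the block algebra, which is `⊕ᵢ ⟨dᵢ,dᵢ,dᵢ⟩`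
(`structureTensor_restrictsTo_of_algEquiv`, `structureTensor_blockBasis_eq_matMulDirectSum`); slice
rank is monotone under restriction, `slice-rank(⊕ᵢ ⟨dᵢ,dᵢ,dᵢ⟩) ≥ Σ dᵢ² = |G|`
(`le_sliceRank_matMulDirectSum`, `sum_sq_eq_card_of_algEquiv`), and `slice-rank(M_G) = slice-rank(D_G)`
(`sliceRank_groupTensor`). The printed proof uses flat rank and Flanders' theorem instead of the
Sawin–Tao antichain bound; the statement is the printed one.
[cite: BlasiakChurchCohnGrochowUmans2017, Cor. B.7] -/
theorem BCCGU2017_corB7_holds : BCCGU2017_corB7 := by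
  intro K _ _ G _ _ _ hG
  refine le_antisymm (sliceRank_le_card _) ?_
  obtain ⟨r, d, _, ⟨φ⟩⟩ := exists_algEquiv_blockAlgebra K G hG
  have hres : TensorRestrictsTo (groupTensor K G) (matMulDirectSum K d d d) := by
    rw [← groupTensor_eq_structureTensor, ← structureTensor_blockBasis_eq_matMulDirectSum]
    exact structureTensor_restrictsTo_of_algEquiv (blockBasis K d) (MonoidAlgebra.basis G K) φ.symm
  calc Fintype.card G = ∑ i, d i ^ 2 := (sum_sq_eq_card_of_algEquiv K G φ).symm
    _ ≤ sliceRank (matMulDirectSum K d d d) := le_sliceRank_matMulDirectSum K d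
    _ ≤ sliceRank (groupTensor K G) := sliceRank_le_of_tensorRestrictsTo hres
    _ = sliceRank (mulGroupTensor K G) := sliceRank_groupTensor K G

/-- **BCCGU 2017, Proposition B.6 (slice-rank part), discharged**: `slice-rank ⟨n,n,n⟩ = n²` — in
fact over every field (the fact is stated for algebraically closed ones; the tree's
`BCCGU2017_propB6.of_field` then also covers every field). `≤ n²` is trivial; `≥`: `⟨n,n,n⟩`
restricts to the one-block direct sum `matMulDirectSum K (n) (n) (n)` (relabelling), whose slice rank
is `≥ n²` (`le_sliceRank_matMulDirectSum`). The printed proof uses flat rank and Flanders' theorem.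
[cite: BlasiakChurchCohnGrochowUmans2017, Prop. B.6] -/
theorem BCCGU2017_propB6_holds : BCCGU2017_propB6 := by
  intro K _ _ n
  apply le_antisymm
  · simpa [sq] using sliceRank_le_card (matMulTensor K n n n)
  · have hres : TensorRestrictsTo (matMulTensor K n n n)
        (matMulDirectSum K (fun _ : Fin 1 => n) (fun _ => n) (fun _ => n)) := by
      have h := tensorRestrictsTo_precomp (matMulTensor K n n n)
        (fun a : (Σ _ : Fin 1, Fin n × Fin n) => a.2) (fun b : (Σ _ : Fin 1, Fin n × Fin n) => b.2)
        (fun c : (Σ _ : Fin 1, Fin n × Fin n) => c.2)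
      convert h using 1
      funext a b c
      obtain ⟨i, a⟩ := a
      obtain ⟨j, b⟩ := b
      obtain ⟨l, c⟩ := c
      obtain rfl : i = j := Subsingleton.elim _ _
      obtain rfl : i = l := Subsingleton.elim _ _
      exact matMulDirectSum_block K (fun _ : Fin 1 => n) (fun _ => n) (fun _ => n) i a b c
    calc n ^ 2 = ∑ _i : Fin 1, n ^ 2 := by simp
      _ ≤ sliceRank (matMulDirectSum K (fun _ : Fin 1 => n) (fun _ => n) (fun _ => n)) :=
          le_sliceRank_matMulDirectSum K (fun _ : Fin 1 => n)
      _ ≤ sliceRank (matMulTensor K n n n) := sliceRank_le_of_tensorRestrictsTo hres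

end Discharge


end Literature.Barriers.MatrixMultiplication

end
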